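import Literature.MathematicalPhysics.QuantumLattice.SectorGibbsMixtureInvariance
import Literature.MathematicalPhysics.QuantumLattice.TorusGibbsEnergyEntropyBalance
import Literature.MathematicalPhysics.QuantumLattice.HubbardNNNHoppingWindowCertificateD4
import Literature.MathematicalPhysics.QuantumLattice.HubbardNNNHoppingCorrelatorCertificate
import Literature.MathematicalPhysics.QuantumLattice.InfVolFermionStatePointGroupAction
import HarnessLib

/-!
# Point-group and translation symmetry of the canonical Gibbs states of the `t–t'` Hubbard torus, and
# `D₄`-invariance of thermal torus-limit states

Topic `Literature/MathematicalPhysics/QuantumLattice`; torus / thermodynamic-limit companion of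
`SectorGibbsMixtureInvariance.lean` (unitary invariance of the canonical sector eigen-mixture) and of
`InfVolFermionStatePointGroupAction.lean` (`ω ∘ γ`, `IsD4Invariant`, and the vanishing of affine-`D₄`
defects in translation- and `D₄`-invariant states). For `H_L = hubbardTorusTT' L t t' U`, the sector
`(rectN n L, S^z = 0)` and its canonical Gibbs data `sectorGibbsWeightTT' β t t' U n`,
`sectorGibbsVectorTT' t t' U n` (`TorusSectorGibbsMixture.lean`):

* §1 the mixture `Σ_i p_{L,i} ⟨U ψ_{L,i}, Y U ψ_{L,i}⟩ = Σ_i p_{L,i} ⟨ψ_{L,i}, Y ψ_{L,i}⟩` is invariant,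
  for every torus operator `Y`, under the point-group unitaries `U = D_γ = fockD4 γ`
  (`sum_sectorGibbsWeightTT'_mul_expect_fockD4_mulVec_eq`; `D_γ` commutes with `H_L` and preserves the
  sector) and under the translations `U = U_v` (`…_fockTranslate_mulVec_eq`);
* §2 the weighted translation average of the `D₄`-image `Γ(d4Emb γ 0 Λ) A ∈ 𝔄_{γΛ}` of a local
  observable equals that of `A` (`sum_sectorGibbsWeightTT'_mul_torusAvgExpectAt_d4Emb`: pull-back
  dictionary `fermionEmbed_toTorusEmb_d4Emb`, `D_γ U_v = U_{γv} D_γ`, reindexing of the average, §1);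
  hence **every torus limit of the canonical sector Gibbs states is `D₄`-invariant**
  (`IsTorusLimitOfMixture.isD4Invariant_of_sectorGibbs`; any `β, t, t', U, n`) and kills every
  affine-`D₄` defect `Γ(incl)(Γ(d4Emb γ w Λ) Y) − Γ(incl) Y` of a window certificate
  (`IsTorusLimitOfMixture.expect_d4Defect_eq_zero_of_sectorGibbs`) — point-group-REDUCED thermal
  certificates are read in thermal torus limits without any orbit averaging (contrast: ground vectors,
  `HubbardNNNHoppingTorusLimitCorrelator.lean`).

Everything is PROVED; no definition, no named fact, no instance.

## Mathlib / tree search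

REUSED: `sum_canonicalWeight_mul_expect_mulVec_eq` (`SectorGibbsMixtureInvariance`),
`apply_eq_zero_off_of_mulVec_mem` (`GibbsEnergyEntropyBalance`), `fockTranslate_val_mul_val_conjTranspose_mul`,
`fockTranslate_apply_eq_zero_of_szConfig`, `fockTranslate_val_conjTranspose_eq_neg` (`TorusGibbsEnergyEntropyBalance`),
`fockD4_commute_hubbardTorusTT'` (`HubbardNNNHoppingWindowCertificateD4`), `fockD4_mulVec_mem_szSector`
(`FockRelabel`), `fockD4_val_conjTranspose`, `fermionEmbed_toTorusEmb_d4Emb` (`HubbardWindowCertificateD4`),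
`fockD4_val_mul_fockTranslate_val` (`HubbardNNNHoppingCorrelatorCertificate`), `relabel_refl`,
`relabel_eq_fockRelabel_conj`, `Orb.translate_zero`, `Fintype.sum_equiv`, `d4Act_expect`,
`IsTranslationInvariant.expect_d4Defect_eq_zero` (`InfVolFermionStatePointGroupAction`),
`IsTorusLimitOfMixture.isTranslationInvariant` (`TorusLimitOfMixtures`). `lean search 'IsD4Invariant'`:
only the vacuum and the abstract ground-state reader (2026-08-26); no Gibbs/thermal instance before.

## References

* X. Han, *Quantum many-body bootstrap*, arXiv:2006.06002 (2020), §3 (point-group constraints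
  `⟨g·O⟩ = ⟨O⟩` of the square lattice). [cite: Han2020Bootstrap, §3]
* D. J. Scalapino, Phys. Rep. 250 (1995) 329, §2 (the point group `C₄ᵥ ≅ D₄` of the square lattice).
  [cite: Scalapino1995, §2]
* R. B. Israel, *Convexity in the Theory of Lattice Gases* (1979), §I.3 eq. (26). [cite: Israel1979, §I.3 eq. (26)]
* O. Bratteli, D. W. Robinson, *OAQSM 2* (1997), §5.2.2 Thm. 5.2.5. [cite: BratteliRobinsonII1997, Thm. 5.2.5]
-/

noncomputable section

namespace Literature.MathematicalPhysics.QuantumLattice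

open Matrix Finset HubbardWave0 Literature.Probability.LatticeModels ThermodynamicLimit
open _root_.Filter
open scoped _root_.Topology ComplexOrder BigOperators

/-! ### §1 The canonical Gibbs mixtures of the `t–t'` torus are invariant under the point group and
the translations -/

section TorusUnitarity

/-- `U(UᴴX) = X` from `UU⋆ = 1`, the `DecidableEq` instance being an implicit ARGUMENT (so that the
lemma instantiates at the instance a unitary-group element carries; cf. `TorusGibbsEnergyEntropyBalance`).
[folklore] -/
private theorem mul_conjTranspose_mul_of_mul_star_self' {ι : Type*} [Fintype ι] {_dec : DecidableEq ι}
    {U : Matrix ι ι ℂ} (h : U * star U = 1) (X : Matrix ι ι ℂ) : U * (Uᴴ * X) = X := by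
  rw [← Matrix.mul_assoc, ← Matrix.star_eq_conjTranspose, h, Matrix.one_mul]

variable (L : ℕ) [NeZero L]

/-- `D_γ (D_γᴴ X) = X` for the point-group unitaries of the torus (instance-free form).
[cite: BratteliRobinsonII1997, §5.2.2, Thm. 5.2.5] -/
theorem fockD4_val_mul_val_conjTranspose_mul (γ : DihedralGroup 4)
    (X : Matrix (Finset (Orb (FermionTorus 2 L))) (Finset (Orb (FermionTorus 2 L))) ℂ) :
    (fockD4 (L := L) γ).val * ((fockD4 (L := L) γ).valᴴ * X) = X :=
  mul_conjTranspose_mul_of_mul_star_self' (fockD4 (L := L) γ).2.2 X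

/-- The point-group unitaries have no entries from the sector `(rectN n L, S^z = 0)` to its
complement (they preserve every joint sector, `fockD4_mulVec_mem_szSector`). [cite: Scalapino1995, §2] -/
theorem fockD4_apply_eq_zero_of_szConfig (γ : DihedralGroup 4) (n : ℝ)
    (s s' : Finset (Orb (FermionTorus 2 L))) (hs : ¬ szConfig n L s) (hs' : szConfig n L s') :
    (fockD4 (L := L) γ).val s s' = 0 :=
  apply_eq_zero_off_of_mulVec_mem (szConfig n L) (szSector (rectN n L) 0) (mem_szSector_rectN_iff n L)
    (fun _ hv => fockD4_mulVec_mem_szSector γ hv) s s' hs hs'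

end TorusUnitarity

section Torus

variable (L : ℕ) [NeZero L]

/-- Canonical weights are invariant under reindexing the family of energies. [folklore] -/
private theorem canonicalWeight_comp_equiv' {κ κ' : Type*} [Fintype κ] [Fintype κ'] (e : κ' ≃ κ)
    (β : ℝ) (E : κ → ℝ) (a : κ') :
    canonicalWeight β (E ∘ e) a = canonicalWeight β E (e a) := by
  unfold canonicalWeight
  rw [show (∑ b, Real.exp (-(β * (E ∘ e) b))) = ∑ b, Real.exp (-(β * E b)) from
    Equiv.sum_comp e (fun b => Real.exp (-(β * E b)))]
  rfl

omit [NeZero L] in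
/-- Transport of the generic invariance to the `Fin`-indexed Gibbs data of the torus: for any torus
operator `U` with `U(UᴴX) = X`, commuting with `H_L = hubbardTorusTT' L t t' U₀` and with `U`, `Uᴴ`
without entries from the sector to its complement, `Σ_i p_{L,i} ⟨Uψ_{L,i}, Y Uψ_{L,i}⟩ = Σ_i p_{L,i} ⟨ψ_{L,i}, Y ψ_{L,i}⟩`.
[cite: Israel1979, §I.3 eq. (26)] -/
theorem sum_sectorGibbsWeightTT'_mul_expect_mulVec_eq (t t' U₀ n β : ℝ)
    {U : Matrix (Finset (Orb (FermionTorus 2 L))) (Finset (Orb (FermionTorus 2 L))) ℂ}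
    (hU' : ∀ X, U * (Uᴴ * X) = X) (hUA : Commute U (hubbardTorusTT' L t t' U₀))
    (hUp : ∀ s s', ¬ szConfig n L s → szConfig n L s' → U s s' = 0)
    (hUp' : ∀ s s', ¬ szConfig n L s → szConfig n L s' → Uᴴ s s' = 0)
    (Y : Matrix (Finset (Orb (FermionTorus 2 L))) (Finset (Orb (FermionTorus 2 L))) ℂ) :
    ∑ i, (sectorGibbsWeightTT' β t t' U₀ n L i : ℂ) * expect Y (U *ᵥ sectorGibbsVectorTT' t t' U₀ n L i) =
      ∑ i, (sectorGibbsWeightTT' β t t' U₀ n L i : ℂ) * expect Y (sectorGibbsVectorTT' t t' U₀ n L i) := by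
  set H := hubbardTorusTT' L t t' U₀ with hH
  have hA : H.IsHermitian := hubbardTorusTT'_isHermitian L t t' U₀
  have hinv : ∀ s s', ¬ szConfig n L s → szConfig n L s' → H s s' = 0 :=
    fun s s' hs hs' => hubbardTorusTT'_apply_eq_zero_of_szConfig L t t' U₀ n s s' hs hs'
  have key := sum_canonicalWeight_mul_expect_mulVec_eq (szConfig n L) hA hinv hU' hUA hUp hUp' β Y
  set e := sectorGibbsIndex n L with he
  have hw : ∀ i, (sectorGibbsWeightTT' β t t' U₀ n L i : ℂ) =
      (canonicalWeight β (sectorEigenvalue (szConfig n L) H hA) (e i) : ℂ) := fun i => by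
    rw [sectorGibbsWeightTT', show sectorGibbsEnergyTT' t t' U₀ n L =
      sectorEigenvalue (szConfig n L) H hA ∘ e from rfl, canonicalWeight_comp_equiv']
  have hv : ∀ i, sectorGibbsVectorTT' t t' U₀ n L i = sectorEigenvector (szConfig n L) H hA (e i) := fun i => rfl
  simp_rw [hw, hv, expect]
  rw [Equiv.sum_comp e (fun a => (canonicalWeight β (sectorEigenvalue (szConfig n L) H hA) a : ℂ) *
      (star (U *ᵥ sectorEigenvector (szConfig n L) H hA a) ⬝ᵥ (Y *ᵥ (U *ᵥ sectorEigenvector (szConfig n L) H hA a)))),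
    Equiv.sum_comp e (fun a => (canonicalWeight β (sectorEigenvalue (szConfig n L) H hA) a : ℂ) *
      (star (sectorEigenvector (szConfig n L) H hA a) ⬝ᵥ (Y *ᵥ sectorEigenvector (szConfig n L) H hA a))), key]

/-- **Point-group invariance of the canonical Gibbs state of the torus**: for every `γ ∈ D₄` and every
torus operator `Y`, `Σ_i p_{L,i} ⟨D_γψ_{L,i}, Y D_γψ_{L,i}⟩ = Σ_i p_{L,i} ⟨ψ_{L,i}, Y ψ_{L,i}⟩`
(`D_γ` commutes with `H_L`, `fockD4_commute_hubbardTorusTT'`, and preserves the sector).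
[cite: Scalapino1995, §2] -/
theorem sum_sectorGibbsWeightTT'_mul_expect_fockD4_mulVec_eq (t t' U n β : ℝ) (γ : DihedralGroup 4)
    (Y : Matrix (Finset (Orb (FermionTorus 2 L))) (Finset (Orb (FermionTorus 2 L))) ℂ) :
    ∑ i, (sectorGibbsWeightTT' β t t' U n L i : ℂ) *
        expect Y ((fockD4 (L := L) γ).val *ᵥ sectorGibbsVectorTT' t t' U n L i) =
      ∑ i, (sectorGibbsWeightTT' β t t' U n L i : ℂ) * expect Y (sectorGibbsVectorTT' t t' U n L i) := by
  refine sum_sectorGibbsWeightTT'_mul_expect_mulVec_eq L t t' U n β (fockD4_val_mul_val_conjTranspose_mul L γ)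
    (fockD4_commute_hubbardTorusTT' γ t t' U) (fockD4_apply_eq_zero_of_szConfig L γ n) (fun s s' hs hs' => ?_) Y
  rw [fockD4_val_conjTranspose]
  exact fockD4_apply_eq_zero_of_szConfig L γ⁻¹ n s s' hs hs'

/-- **Translation invariance of the canonical Gibbs state of the torus** (the same for `U_v`).
[cite: Israel1979, §I.3 eq. (26)] -/
theorem sum_sectorGibbsWeightTT'_mul_expect_fockTranslate_mulVec_eq (t t' U n β : ℝ) (v : TorusSite 2 L)
    (Y : Matrix (Finset (Orb (FermionTorus 2 L))) (Finset (Orb (FermionTorus 2 L))) ℂ) :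
    ∑ i, (sectorGibbsWeightTT' β t t' U n L i : ℂ) *
        expect Y ((fockTranslate v).val *ᵥ sectorGibbsVectorTT' t t' U n L i) =
      ∑ i, (sectorGibbsWeightTT' β t t' U n L i : ℂ) * expect Y (sectorGibbsVectorTT' t t' U n L i) := by
  refine sum_sectorGibbsWeightTT'_mul_expect_mulVec_eq L t t' U n β (fockTranslate_val_mul_val_conjTranspose_mul L v)
    (fockTranslate_commute_hubbardTorusTT' L v t t' U) (fockTranslate_apply_eq_zero_of_szConfig L v n)
    (fun s s' hs hs' => ?_) Y
  rw [fockTranslate_val_conjTranspose_eq_neg]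
  exact fockTranslate_apply_eq_zero_of_szConfig L (-v) n s s' hs hs'

/-! ### §2 Translation averages of point-group images, and `D₄`-invariance of thermal torus limits -/

/-- **The weighted translation average of the `D₄`-image of a local observable equals that of the
observable** in the canonical Gibbs mixture of the torus: for `γ ∈ D₄`, a region `Λ` with `Λ` and `γΛ`
fitting into the torus, and `A ∈ 𝔄_Λ`,
`Σ_i p_{L,i} · torusAvgExpectAt L (γΛ) (Γ(d4Emb γ 0 Λ) A) ψ_{L,i} = Σ_i p_{L,i} · torusAvgExpectAt L Λ A ψ_{L,i}`
(pull-back dictionary `fermionEmbed_toTorusEmb_d4Emb`, `D_γ U_v = U_{γv} D_γ`, reindexing of the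
translation average, and the point-group invariance of the Gibbs mixture).
[cite: Han2020Bootstrap, §3] -/
theorem sum_sectorGibbsWeightTT'_mul_torusAvgExpectAt_d4Emb (t t' U n β : ℝ) (γ : DihedralGroup 4)
    {Λ : Finset (Site 2)} (hInj : Set.InjOn (Torus.proj (d := 2) L) ↑Λ)
    (hInj' : Set.InjOn (Torus.proj (d := 2) L) ↑(d4ShiftSet γ 0 Λ)) (A : FermionOp Λ) :
    ∑ i, (sectorGibbsWeightTT' β t t' U n L i : ℂ) *
        torusAvgExpectAt L (d4ShiftSet γ 0 Λ) (fermionEmbed (PolySite.d4Emb γ 0 Λ) A)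
          (sectorGibbsVectorTT' t t' U n L i) =
      ∑ i, (sectorGibbsWeightTT' β t t' U n L i : ℂ) *
        torusAvgExpectAt L Λ A (sectorGibbsVectorTT' t t' U n L i) := by
  set B := fermionEmbed (PolySite.toTorusEmb L hInj) A with hB
  set D' := (fockD4 (L := L) γ⁻¹).val with hD'
  have hproj : Torus.proj L (0 : Site 2) = 0 := by funext i; simp [Torus.proj]
  -- the pulled-back image is `D_γ B D_γᴴ`
  have hpull : fermionEmbed (PolySite.toTorusEmb L hInj') (fermionEmbed (PolySite.d4Emb γ 0 Λ) A) =
      (fockD4 (L := L) γ).val * B * (fockD4 (L := L) γ).valᴴ := by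
    rw [fermionEmbed_toTorusEmb_d4Emb γ 0 hInj hInj' A, hproj, Orb.translate_zero, Equiv.Perm.one_def,
      relabel_refl, relabel_eq_fockRelabel_conj, ← fockD4_apply]
  -- `⟨U_vψ, D B Dᴴ U_vψ⟩ = ⟨U_{γ⁻¹v} D' ψ, B U_{γ⁻¹v} D' ψ⟩`
  have hterm : ∀ (v : TorusSite 2 L) (ψ : Fock (Orb (FermionTorus 2 L))),
      expect ((fockD4 (L := L) γ).val * B * (fockD4 (L := L) γ).valᴴ) ((fockTranslate v).val *ᵥ ψ) =
        expect B ((fockTranslate (d4Site γ⁻¹ v)).val *ᵥ (D' *ᵥ ψ)) := by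
    intro v ψ
    have hvec : (fockTranslate (d4Site γ⁻¹ v)).val *ᵥ (D' *ᵥ ψ) =
        (fockD4 (L := L) γ).valᴴ *ᵥ ((fockTranslate v).val *ᵥ ψ) := by
      rw [mulVec_mulVec, mulVec_mulVec, hD', ← fockD4_val_mul_fockTranslate_val, fockD4_val_conjTranspose]
    rw [expect, expect, hvec, star_mulVec_dotProduct_mulVec_mulVec (fockD4 (L := L) γ).valᴴ B,
      conjTranspose_conjTranspose]
  -- reindex the translation average
  have havg : ∀ ψ : Fock (Orb (FermionTorus 2 L)),
      torusAvgExpectAt L (d4ShiftSet γ 0 Λ) (fermionEmbed (PolySite.d4Emb γ 0 Λ) A) ψ =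
        torusAvgExpectAt L Λ A (D' *ᵥ ψ) := by
    intro ψ
    rw [torusAvgExpectAt_of_injOn L hInj', torusAvgExpectAt_of_injOn L hInj, hpull,
      Finset.sum_congr rfl fun v _ => hterm v ψ,
      Fintype.sum_equiv (d4SitePerm (L := L) γ⁻¹)
        (fun v => expect B ((fockTranslate (d4Site γ⁻¹ v)).val *ᵥ (D' *ᵥ ψ)))
        (fun u => expect B ((fockTranslate u).val *ᵥ (D' *ᵥ ψ))) (fun v => by rw [d4SitePerm_apply])]
  -- `⟨U_u φ, B U_u φ⟩ = ⟨φ, (U_uᴴ B U_u) φ⟩`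
  have h1 : ∀ (u : TorusSite 2 L) (φ : Fock (Orb (FermionTorus 2 L))), expect B ((fockTranslate u).val *ᵥ φ) =
      expect ((fockTranslate u).valᴴ * B * (fockTranslate u).val) φ := fun u φ => by
    rw [expect, expect, star_mulVec_dotProduct_mulVec_mulVec (fockTranslate u).val B]
  -- both sides as `|𝕋|⁻¹ Σ_u Σ_i p_i ⟨·⟩`
  have hswap : ∀ χ : Fin (sectorGibbsCount n L) → Fock (Orb (FermionTorus 2 L)),
      ∑ i, (sectorGibbsWeightTT' β t t' U n L i : ℂ) * torusAvgExpectAt L Λ A (χ i) =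
        ((Fintype.card (TorusSite 2 L) : ℂ))⁻¹ * ∑ u : TorusSite 2 L, ∑ i,
          (sectorGibbsWeightTT' β t t' U n L i : ℂ) *
            expect ((fockTranslate u).valᴴ * B * (fockTranslate u).val) (χ i) := by
    intro χ
    rw [Finset.sum_comm, Finset.mul_sum]
    refine Finset.sum_congr rfl fun i _ => ?_
    rw [torusAvgExpectAt_of_injOn L hInj, Finset.mul_sum, Finset.mul_sum, Finset.mul_sum]
    refine Finset.sum_congr rfl fun u _ => ?_
    rw [h1, mul_left_comm]
  rw [Finset.sum_congr rfl fun i _ => by rw [havg], hswap (fun i => D' *ᵥ sectorGibbsVectorTT' t t' U n L i),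
    hswap (fun i => sectorGibbsVectorTT' t t' U n L i)]
  refine congrArg (fun z => ((Fintype.card (TorusSite 2 L) : ℂ))⁻¹ * z) (Finset.sum_congr rfl fun u _ => ?_)
  exact sum_sectorGibbsWeightTT'_mul_expect_fockD4_mulVec_eq L t t' U n β γ⁻¹ _

namespace InfVolFermionState

/-- **Thermal torus limits are point-group invariant.** Every torus limit `ω` of the canonical Gibbs
states of `hubbardTorusTT' (Ls j) t t' U` at inverse temperature `β` on the sectors
`(rectN n (Ls j), S^z = 0)` (`Ls → ∞`; any `β, t, t', U, n`) satisfies `ω ∘ γ = ω` for every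
`γ ∈ D₄` (`IsD4Invariant`): the finite-volume Gibbs states are EXACTLY invariant (unlike ground
VECTORS of a degenerate multiplet), so point-group-reduced certificates are read in thermal torus
limits without any orbit averaging. [cite: Han2020Bootstrap, §3] -/
theorem IsTorusLimitOfMixture.isD4Invariant_of_sectorGibbs (t t' U n β : ℝ)
    {ω : InfVolFermionState 2} {Ls : ℕ → ℕ}
    (h : ω.IsTorusLimitOfMixture (sectorGibbsCount n) (fun L => sectorGibbsWeightTT' β t t' U n L)
      (fun L => sectorGibbsVectorTT' t t' U n L) Ls)
    (hLs : Tendsto Ls atTop atTop) : ω.IsD4Invariant := by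
  intro γ
  refine InfVolFermionState.ext fun Λ => LinearMap.ext fun A => ?_
  rw [d4Act_expect]
  refine tendsto_nhds_unique (h (d4ShiftSet γ 0 Λ) (fermionEmbed (PolySite.d4Emb γ 0 Λ) A)) ((h Λ A).congr' ?_)
  filter_upwards [eventually_injOn_proj_of_tendsto Λ hLs, eventually_injOn_proj_of_tendsto (d4ShiftSet γ 0 Λ) hLs,
    hLs.eventually_ge_atTop 1] with j h1 h2 hj
  haveI : NeZero (Ls j) := ⟨by omega⟩
  simp_rw [torusAvgExpect_eq]
  exact (sum_sectorGibbsWeightTT'_mul_torusAvgExpectAt_d4Emb (Ls j) t t' U n β γ h1 h2 A).symm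

/-- **Thermal torus limits kill every affine-`D₄` defect of a window certificate**:
`ω_{Λ'}(Γ(incl)(Γ(d4Emb γ w Λ) Y) − Γ(incl) Y) = 0` for all `γ ∈ D₄`, `w ∈ ℤ²`, `Λ ⊆ Λ'`, `γΛ + w ⊆ Λ'`
(translation invariance `IsTorusLimitOfMixture.isTranslationInvariant` and `D₄`-invariance).
[cite: Han2020Bootstrap, §3] -/
theorem IsTorusLimitOfMixture.expect_d4Defect_eq_zero_of_sectorGibbs (t t' U n β : ℝ)
    {ω : InfVolFermionState 2} {Ls : ℕ → ℕ}
    (h : ω.IsTorusLimitOfMixture (sectorGibbsCount n) (fun L => sectorGibbsWeightTT' β t t' U n L)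
      (fun L => sectorGibbsVectorTT' t t' U n L) Ls)
    (hLs : Tendsto Ls atTop atTop) {Λ Λ' : Finset (Site 2)} (hΛ : Λ ⊆ Λ')
    (γ : DihedralGroup 4) (w : Site 2) (hsh : d4ShiftSet γ w Λ ⊆ Λ') (Y : FermionOp Λ) :
    ω.expect Λ' (fermionEmbed (PolySite.incl hsh) (fermionEmbed (PolySite.d4Emb γ w Λ) Y) -
      fermionEmbed (PolySite.incl hΛ) Y) = 0 :=
  h.isTranslationInvariant.expect_d4Defect_eq_zero (h.isD4Invariant_of_sectorGibbs t t' U n β hLs) hΛ γ w hsh Y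

end InfVolFermionState

end Torus

end Literature.MathematicalPhysics.QuantumLattice

end
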